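import Mathlib.RingTheory.DiscreteValuationRing.Basic
import Mathlib.RingTheory.PowerSeries.Trunc
import Mathlib.RingTheory.LaurentSeries
import Mathlib.RingTheory.Filtration
import Mathlib.Algebra.Polynomial.Div
import Mathlib.Algebra.Polynomial.Inductions
import Mathlib.RingTheory.Localization.FractionRing
import HarnessLib

/-!
# Power-series expansion of a discrete valuation ring with coefficient field
# (the completion step of Hilbert's / Kraft's curve lemma)

Let `V` be a discrete valuation ring which is an algebra over a field `k` such that every residue
class is represented by a constant: `∀ v, ∃ c : k, v − c ∈ 𝔫` (a *coefficient field*; automatic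
when `k` is algebraically closed and `V/𝔫` is algebraic over `k`, e.g. for the local ring of a
point of an algebraic curve over `k`). Then, `ϖ` being a uniformizer, every `v ∈ V` has a unique
expansion `v = ∑_i c_i ϖ^i`, `c_i ∈ k`, in the sense that `v − ∑_{i<n} c_i ϖ^i ∈ 𝔫ⁿ` for all `n`,
and `v ↦ ∑ c_i εⁱ` is an injective `k`-algebra homomorphism `V → k[[ε]]` whose constant coefficient
is the residue map; it extends to the fraction field, `Frac V → k((ε))`. This is the passage
"`𝒪̂_{C,c} ≅ ℂ[[t]]`, `ℂ(C) ⊂ ℂ((t))`" in the proof of Kraft's Lemma III.2.3/1 (Hilbert 1893), used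
by Bürgisser–Landsberg–Manivel–Weyman 2011, Lemma 9.4.1 (cell val-lit, row BLMW2011-B; brick D
of the route note for `BLMW2011_lemma_9_4_1`). Everything here is PROVED; no named facts, no new
notions (the expansion property is kept as an explicit hypothesis
`∀ n, v - aeval ϖ (trunc n F) ∈ 𝔫 ^ n` rather than a definition).

Main results (namespace `Literature.RingTheory.DiscreteValuationRing.CoefficientField`):
* `eq_zero_of_aeval_mem_pow` — uniqueness: a polynomial over `k` with coefficients vanishing from
  degree `n` on and `p(ϖ) ∈ 𝔫ⁿ` is zero;
* `exists_expansion` — existence of the expansion; `expansion_unique`, `expansion_add`,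
  `expansion_mul`, `expansion_algebraMap`;
* `exists_algHom_powerSeries` — the injective `k`-algebra map `ψ : V →ₐ[k] k⟦X⟧` with
  `v − constantCoeff (ψ v) ∈ 𝔫` (and `ψ ϖ = X`);
* `exists_algHom_laurentSeries` — its extension `Frac V →ₐ[k] k⸨X⸩`.

Honest framing: standard commutative algebra (a special case of Cohen's structure theorem),
formalised as infrastructure for a closure lemma of geometric complexity theory; nothing here
bears on lower bounds or on `VP` versus `VNP`.

## References

* [Kraft1984] H. Kraft, *Geometrische Methoden in der Invariantentheorie*, Vieweg 1984, III.2.3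
  (proof of Lemma 1: completion of the local ring of a smooth curve point, `K(C) ⊂ ℂ((t))`).
* [BurgisserEtAl2011] P. Bürgisser, J. M. Landsberg, L. Manivel, J. Weyman, SIAM J. Comput. 40
  (2011), arXiv:0907.2850, §9.4, Lemma 9.4.1 ("`R = ℂ[[ε]]` … `K = ℂ((ε))`").
-/

noncomputable section

namespace Literature.RingTheory.DiscreteValuationRing

namespace CoefficientField

open Polynomial PowerSeries IsLocalRing

universe u v w

variable {k : Type u} [Field k] {V : Type v} [CommRing V] [IsDomain V] [IsDiscreteValuationRing V]
  [Algebra k V]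

/-! ### Uniformizer bookkeeping -/

/-- A uniformizer generates the maximal ideal, hence lies in it. [cite: Kraft1984, III.2.3 (proof of Lemma 1)] -/
theorem uniformizer_mem {ϖ : V} (hϖ : Irreducible ϖ) : ϖ ∈ maximalIdeal V := by
  rw [(IsDiscreteValuationRing.irreducible_iff_uniformizer ϖ).mp hϖ]
  exact Ideal.mem_span_singleton_self ϖ

/-- `𝔫ⁿ = (ϖⁿ)`. [cite: Kraft1984, III.2.3 (proof of Lemma 1)] -/
theorem maximalIdeal_pow_eq {ϖ : V} (hϖ : Irreducible ϖ) (n : ℕ) :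
    maximalIdeal V ^ n = Ideal.span {ϖ ^ n} := by
  rw [(IsDiscreteValuationRing.irreducible_iff_uniformizer ϖ).mp hϖ, Ideal.span_singleton_pow]

/-- A non-zero constant is a unit, so a constant in `𝔫` is zero. [cite: Kraft1984, III.2.3 (proof of Lemma 1)] -/
theorem eq_zero_of_algebraMap_mem {c : k} (hc : algebraMap k V c ∈ maximalIdeal V) : c = 0 := by
  by_contra hne
  exact (IsLocalRing.mem_maximalIdeal _).mp hc ((IsUnit.mk0 c hne).map (algebraMap k V))

/-- `p(ϖ) ∈ 𝔫ⁿ` as soon as the coefficients of `p` below `n` vanish. [cite: Kraft1984, III.2.3 (proof of Lemma 1)] -/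
theorem aeval_mem_pow_of_coeff_eq_zero {ϖ : V} (hϖ : ϖ ∈ maximalIdeal V) (p : k[X]) (n : ℕ)
    (h : ∀ d < n, p.coeff d = 0) : Polynomial.aeval ϖ p ∈ maximalIdeal V ^ n := by
  obtain ⟨q, rfl⟩ := Polynomial.X_pow_dvd_iff.mpr h
  rw [map_mul, map_pow, Polynomial.aeval_X]
  exact Ideal.mul_mem_right _ _ (Ideal.pow_mem_pow hϖ n)

/-! ### Uniqueness of expansions -/

/-- **Uniqueness.** A polynomial `p ∈ k[X]` whose coefficients vanish from degree `n` on and with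
`p(ϖ) ∈ 𝔫ⁿ` is zero: its constant coefficient is a constant in `𝔫`, hence `0`, and one divides
by `ϖ`. [cite: Kraft1984, III.2.3 (proof of Lemma 1)] -/
theorem eq_zero_of_aeval_mem_pow {ϖ : V} (hϖ : Irreducible ϖ) :
    ∀ (n : ℕ) (p : k[X]), (∀ d, n ≤ d → p.coeff d = 0) →
      Polynomial.aeval ϖ p ∈ maximalIdeal V ^ n → p = 0 := by
  intro n
  induction n with
  | zero =>
    intro p hp _
    ext d
    simpa using hp d (Nat.zero_le d)
  | succ n ih =>
    intro p hp hmem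
    have hdecomp := Polynomial.X_mul_divX_add p
    have hq : ∀ d, n ≤ d → p.divX.coeff d = 0 := fun d hd => by
      rw [Polynomial.coeff_divX]
      exact hp (d + 1) (by omega)
    have hev : Polynomial.aeval ϖ p =
        ϖ * Polynomial.aeval ϖ p.divX + algebraMap k V (p.coeff 0) := by
      conv_lhs => rw [← hdecomp]
      rw [map_add, map_mul, Polynomial.aeval_X, Polynomial.aeval_C]
    have hϖmem := uniformizer_mem hϖ
    have hmem1 : Polynomial.aeval ϖ p ∈ maximalIdeal V :=
      Ideal.pow_le_self (Nat.succ_ne_zero n) hmem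
    have hc0 : algebraMap k V (p.coeff 0) ∈ maximalIdeal V := by
      have h2 : ϖ * Polynomial.aeval ϖ p.divX ∈ maximalIdeal V := Ideal.mul_mem_right _ _ hϖmem
      have := Ideal.sub_mem _ hmem1 h2
      rwa [hev, add_sub_cancel_left] at this
    have hp0 : p.coeff 0 = 0 := eq_zero_of_algebraMap_mem hc0
    have hmem' : ϖ * Polynomial.aeval ϖ p.divX ∈ Ideal.span {ϖ ^ (n + 1)} := by
      rw [← maximalIdeal_pow_eq hϖ]
      rw [hev, hp0, map_zero, add_zero] at hmem
      exact hmem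
    obtain ⟨w, hw⟩ := Ideal.mem_span_singleton'.mp hmem'
    have hqmem : Polynomial.aeval ϖ p.divX ∈ maximalIdeal V ^ n := by
      rw [maximalIdeal_pow_eq hϖ, Ideal.mem_span_singleton']
      refine ⟨w, mul_left_cancel₀ hϖ.ne_zero ?_⟩
      rw [← hw]
      ring
    have hq0 : p.divX = 0 := ih p.divX hq hqmem
    rw [← hdecomp, hq0, hp0, map_zero, mul_zero, zero_add]

/-- **Expansions are unique**: if `F` and `G` are both `ϖ`-adic expansions of `v`
(`v − (trunc n F)(ϖ) ∈ 𝔫ⁿ` for all `n`), then `F = G`. [cite: Kraft1984, III.2.3 (proof of Lemma 1)] -/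
theorem expansion_unique {ϖ : V} (hϖ : Irreducible ϖ) {v : V} {F G : k⟦X⟧}
    (hF : ∀ n, v - Polynomial.aeval ϖ (trunc n F) ∈ maximalIdeal V ^ n)
    (hG : ∀ n, v - Polynomial.aeval ϖ (trunc n G) ∈ maximalIdeal V ^ n) : F = G := by
  ext m
  have h0 : trunc (m + 1) F - trunc (m + 1) G = 0 := by
    refine eq_zero_of_aeval_mem_pow hϖ (m + 1) _ (fun d hd => ?_) ?_
    · rw [Polynomial.coeff_sub, coeff_trunc, coeff_trunc, if_neg (by omega), if_neg (by omega),
        sub_zero]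
    · have : Polynomial.aeval ϖ (trunc (m + 1) F - trunc (m + 1) G) =
          (v - Polynomial.aeval ϖ (trunc (m + 1) G)) - (v - Polynomial.aeval ϖ (trunc (m + 1) F)) := by
        rw [map_sub]; ring
      rw [this]
      exact Ideal.sub_mem _ (hG _) (hF _)
  have := congrArg (fun r : k[X] => r.coeff m) (sub_eq_zero.mp h0)
  simpa only [coeff_trunc, Nat.lt_succ_self, if_true] using this

/-! ### Existence of expansions -/

/-- **Existence.** If every residue class of `V` is represented by a constant of `k`, every `v ∈ V`
has a `ϖ`-adic expansion `F ∈ k[[X]]`: `v − (trunc n F)(ϖ) ∈ 𝔫ⁿ` for all `n` (successive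
approximation `v = c₀ + ϖ v₁`, `v₁ = c₁ + ϖ v₂`, …; the truncations are coherent by
uniqueness). [cite: Kraft1984, III.2.3 (proof of Lemma 1)] -/
theorem exists_expansion (hres : ∀ v : V, ∃ c : k, v - algebraMap k V c ∈ maximalIdeal V)
    {ϖ : V} (hϖ : Irreducible ϖ) (v : V) :
    ∃ F : k⟦X⟧, ∀ n, v - Polynomial.aeval ϖ (trunc n F) ∈ maximalIdeal V ^ n := by
  have hϖmem := uniformizer_mem hϖ
  -- approximants of every order
  have happrox : ∀ n, ∃ p : k[X], (∀ d, n ≤ d → p.coeff d = 0) ∧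
      v - Polynomial.aeval ϖ p ∈ maximalIdeal V ^ n := by
    intro n
    induction n with
    | zero => exact ⟨0, fun d _ => by simp, by simp⟩
    | succ n ih =>
      obtain ⟨p, hp, hmem⟩ := ih
      rw [maximalIdeal_pow_eq hϖ, Ideal.mem_span_singleton'] at hmem
      obtain ⟨w, hw⟩ := hmem
      obtain ⟨c, hc⟩ := hres w
      refine ⟨p + Polynomial.C c * Polynomial.X ^ n, fun d hd => ?_, ?_⟩
      · rw [Polynomial.coeff_add, Polynomial.coeff_C_mul_X_pow, hp d (by omega), if_neg (by omega),
          add_zero]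
      · have : v - Polynomial.aeval ϖ (p + Polynomial.C c * Polynomial.X ^ n) =
            (w - algebraMap k V c) * ϖ ^ n := by
          rw [map_add, map_mul, map_pow, Polynomial.aeval_X, Polynomial.aeval_C, ← sub_sub, ← hw]
          ring
        rw [this, pow_succ']
        exact Ideal.mul_mem_mul hc (Ideal.pow_mem_pow hϖmem n)
  choose p hp hmem using happrox
  -- coherence of the approximants
  have hcompat : ∀ n d, d < n → (p n).coeff d = (p (d + 1)).coeff d := by
    intro n d hd
    set q : k[X] := trunc (d + 1) ((p n : k[X]) : k⟦X⟧) with hq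
    have hq_coeff : ∀ m, q.coeff m = if m < d + 1 then (p n).coeff m else 0 := fun m => by
      rw [hq, coeff_trunc, Polynomial.coeff_coe]
    have h1 : v - Polynomial.aeval ϖ q ∈ maximalIdeal V ^ (d + 1) := by
      have hsplit : v - Polynomial.aeval ϖ q =
          (v - Polynomial.aeval ϖ (p n)) + Polynomial.aeval ϖ (p n - q) := by
        rw [map_sub]; ring
      rw [hsplit]
      refine Ideal.add_mem _ (Ideal.pow_le_pow_right (by omega) (hmem n)) ?_
      exact aeval_mem_pow_of_coeff_eq_zero hϖmem _ _ fun m hm => by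
        rw [Polynomial.coeff_sub, hq_coeff, if_pos hm, sub_self]
    have hdiff : q - p (d + 1) = 0 := by
      refine eq_zero_of_aeval_mem_pow hϖ (d + 1) _ (fun m hm => ?_) ?_
      · rw [Polynomial.coeff_sub, hq_coeff, if_neg (by omega), (hp (d + 1)) m hm, sub_zero]
      · have : Polynomial.aeval ϖ (q - p (d + 1)) =
            (v - Polynomial.aeval ϖ (p (d + 1))) - (v - Polynomial.aeval ϖ q) := by
          rw [map_sub]; ring
        rw [this]
        exact Ideal.sub_mem _ (hmem (d + 1)) h1
    have := congrArg (fun r : k[X] => r.coeff d) (sub_eq_zero.mp hdiff)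
    rw [← this, hq_coeff, if_pos (Nat.lt_succ_self d)]
  -- glue
  refine ⟨PowerSeries.mk fun d => (p (d + 1)).coeff d, fun n => ?_⟩
  have htrunc : trunc n (PowerSeries.mk fun d => (p (d + 1)).coeff d) = p n := by
    ext m
    rw [coeff_trunc]
    split_ifs with hm
    · rw [coeff_mk, hcompat n m hm]
    · exact ((hp n) m (not_lt.mp hm)).symm
  rw [htrunc]
  exact hmem n

/-! ### The expansion respects the ring operations -/

section Closure

variable {ϖ : V}

/-- Constants expand to constants. [cite: Kraft1984, III.2.3 (proof of Lemma 1)] -/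
theorem expansion_algebraMap (c : k) :
    ∀ n, algebraMap k V c - Polynomial.aeval ϖ (trunc n (PowerSeries.C c)) ∈ maximalIdeal V ^ n := by
  intro n
  rcases n with _ | n
  · simp
  · rw [trunc_C, Polynomial.aeval_C, sub_self]
    exact Submodule.zero_mem _

/-- Sums expand to sums. [cite: Kraft1984, III.2.3 (proof of Lemma 1)] -/
theorem expansion_add {v w : V} {F G : k⟦X⟧}
    (hF : ∀ n, v - Polynomial.aeval ϖ (trunc n F) ∈ maximalIdeal V ^ n)
    (hG : ∀ n, w - Polynomial.aeval ϖ (trunc n G) ∈ maximalIdeal V ^ n) :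
    ∀ n, (v + w) - Polynomial.aeval ϖ (trunc n (F + G)) ∈ maximalIdeal V ^ n := by
  intro n
  have : (v + w) - Polynomial.aeval ϖ (trunc n (F + G)) =
      (v - Polynomial.aeval ϖ (trunc n F)) + (w - Polynomial.aeval ϖ (trunc n G)) := by
    rw [map_add, map_add]; ring
  rw [this]
  exact Ideal.add_mem _ (hF n) (hG n)

/-- Products expand to products: `trunc n F · trunc n G ≡ trunc n (F G)` modulo `Xⁿ`
(`PowerSeries.trunc_trunc_mul_trunc`). [cite: Kraft1984, III.2.3 (proof of Lemma 1)] -/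
theorem expansion_mul (hϖ : ϖ ∈ maximalIdeal V) {v w : V} {F G : k⟦X⟧}
    (hF : ∀ n, v - Polynomial.aeval ϖ (trunc n F) ∈ maximalIdeal V ^ n)
    (hG : ∀ n, w - Polynomial.aeval ϖ (trunc n G) ∈ maximalIdeal V ^ n) :
    ∀ n, (v * w) - Polynomial.aeval ϖ (trunc n (F * G)) ∈ maximalIdeal V ^ n := by
  intro n
  have hr : ∀ d < n, (trunc n F * trunc n G - trunc n (F * G)).coeff d = 0 := by
    intro d hd
    have h := congrArg (fun r : k[X] => r.coeff d) (trunc_trunc_mul_trunc (n := n) F G)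
    simp only [coeff_trunc, if_pos hd] at h
    rw [← Polynomial.coe_mul, Polynomial.coeff_coe] at h
    rw [Polynomial.coeff_sub, coeff_trunc, if_pos hd, h, sub_self]
  have hmemr := aeval_mem_pow_of_coeff_eq_zero hϖ _ n hr
  have hsplit : v * w - Polynomial.aeval ϖ (trunc n (F * G)) =
      v * (w - Polynomial.aeval ϖ (trunc n G)) +
        (v - Polynomial.aeval ϖ (trunc n F)) * Polynomial.aeval ϖ (trunc n G) +
        Polynomial.aeval ϖ (trunc n F * trunc n G - trunc n (F * G)) := by
    simp only [map_sub, map_mul]; ring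
  rw [hsplit]
  exact Ideal.add_mem _ (Ideal.add_mem _ (Ideal.mul_mem_left _ _ (hG n))
    (Ideal.mul_mem_right _ _ (hF n))) hmemr

/-- The uniformizer expands to `X`. [cite: Kraft1984, III.2.3 (proof of Lemma 1)] -/
theorem expansion_uniformizer (hϖ : ϖ ∈ maximalIdeal V) :
    ∀ n, ϖ - Polynomial.aeval ϖ (trunc n (PowerSeries.X : k⟦X⟧)) ∈ maximalIdeal V ^ n := by
  intro n
  rcases n with _ | _ | n
  · simp
  · rw [trunc_one_X, map_zero, sub_zero, pow_one]
    exact hϖ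
  · rw [trunc_X_of (by omega), Polynomial.aeval_X, sub_self]
    exact Submodule.zero_mem _

/-- The constant coefficient of the expansion is the residue: `v − F(0) ∈ 𝔫`.
[cite: Kraft1984, III.2.3 (proof of Lemma 1)] -/
theorem sub_constantCoeff_mem {v : V} {F : k⟦X⟧}
    (hF : ∀ n, v - Polynomial.aeval ϖ (trunc n F) ∈ maximalIdeal V ^ n) :
    v - algebraMap k V (PowerSeries.constantCoeff F) ∈ maximalIdeal V := by
  have h := hF 1
  rwa [trunc_one_left, Polynomial.aeval_C, pow_one, coeff_zero_eq_constantCoeff_apply] at h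

/-- Only `0` expands to `0` (Krull's intersection theorem). [cite: Kraft1984, III.2.3 (proof of Lemma 1)] -/
theorem eq_zero_of_expansion_zero {v : V}
    (hF : ∀ n, v - Polynomial.aeval ϖ (trunc n (0 : k⟦X⟧)) ∈ maximalIdeal V ^ n) : v = 0 := by
  have hv : v ∈ ⨅ n : ℕ, maximalIdeal V ^ n := by
    refine Ideal.mem_iInf.mpr fun n => ?_
    simpa using hF n
  rwa [Ideal.iInf_pow_eq_bot_of_isLocalRing _ (IsLocalRing.maximalIdeal.isMaximal V).ne_top,
    Ideal.mem_bot] at hv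

end Closure

/-! ### The embeddings `V ↪ k[[X]]` and `Frac V ↪ k((X))` -/

/-- **Power-series expansion as a `k`-algebra embedding.** For a discrete valuation ring `V` over
a field `k` representing all residue classes, there is an injective `k`-algebra homomorphism
`ψ : V → k[[X]]` whose constant coefficient is the residue map (`v − ψ(v)(0) ∈ 𝔫`), sending a
chosen uniformizer to `X` and the maximal ideal into `(X)`. [cite: Kraft1984, III.2.3 (proof of Lemma 1)] -/
theorem exists_algHom_powerSeries
    (hres : ∀ v : V, ∃ c : k, v - algebraMap k V c ∈ maximalIdeal V) :
    ∃ ψ : V →ₐ[k] k⟦X⟧, Function.Injective ψ ∧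
      (∀ v : V, v - algebraMap k V (PowerSeries.constantCoeff (ψ v)) ∈ maximalIdeal V) ∧
      (∀ v ∈ maximalIdeal V, PowerSeries.constantCoeff (ψ v) = 0) ∧
      ∃ ϖ : V, Irreducible ϖ ∧ ψ ϖ = PowerSeries.X := by
  obtain ⟨ϖ, hϖ⟩ := IsDiscreteValuationRing.exists_irreducible V
  have hϖmem := uniformizer_mem hϖ
  choose F hF using exists_expansion hres hϖ
  have huniq : ∀ {v : V} {G : k⟦X⟧},
      (∀ n, v - Polynomial.aeval ϖ (trunc n G) ∈ maximalIdeal V ^ n) → F v = G :=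
    fun {v} {G} hG => expansion_unique hϖ (hF v) hG
  let ψ : V →ₐ[k] k⟦X⟧ :=
    { toFun := F
      map_one' := by
        refine huniq fun n => ?_
        simpa only [map_one] using expansion_algebraMap (ϖ := ϖ) (1 : k) n
      map_mul' := fun v w => huniq (expansion_mul hϖmem (hF v) (hF w))
      map_zero' := by
        refine huniq fun n => ?_
        simpa only [map_zero] using expansion_algebraMap (ϖ := ϖ) (0 : k) n
      map_add' := fun v w => huniq (expansion_add (hF v) (hF w))
      commutes' := fun c => huniq (expansion_algebraMap c) }
  have hψ : ∀ v, ψ v = F v := fun v => rfl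
  refine ⟨ψ, fun v w hvw => ?_, fun v => ?_, fun v hv => ?_, ⟨ϖ, hϖ, ?_⟩⟩
  · -- injective
    rw [← sub_eq_zero]
    have h0 : ψ (v - w) = 0 := by rw [map_sub, hvw, sub_self]
    rw [hψ] at h0
    exact eq_zero_of_expansion_zero (ϖ := ϖ) (by simpa only [h0] using hF (v - w))
  · exact sub_constantCoeff_mem (hF v)
  · -- on the maximal ideal the residue vanishes
    have h := sub_constantCoeff_mem (hF v)
    have : algebraMap k V (PowerSeries.constantCoeff (F v)) ∈ maximalIdeal V := by
      simpa using Ideal.sub_mem _ hv h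
    exact eq_zero_of_algebraMap_mem this
  · exact huniq (expansion_uniformizer hϖmem)

/-- **Extension to the fraction field**: `Frac V → k((X))`, a `k`-algebra homomorphism under which
every element of `V` becomes a power series whose constant coefficient is its residue
("`K(C) ⊂ ℂ((t))`" in Kraft's proof; BLMW's `σ ∈ GL_N(K)`, `K = ℂ((ε))`).
[cite: Kraft1984, III.2.3 (proof of Lemma 1)] [cite: BurgisserEtAl2011, Lemma 9.4.1 (proof)] -/
theorem exists_algHom_laurentSeries
    (hres : ∀ v : V, ∃ c : k, v - algebraMap k V c ∈ maximalIdeal V)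
    (L : Type w) [Field L] [Algebra V L] [IsFractionRing V L] [Algebra k L] [IsScalarTower k V L] :
    ∃ Ψ : L →ₐ[k] LaurentSeries k,
      ∀ v : V, ∃ q : k⟦X⟧, Ψ (algebraMap V L v) = (q : LaurentSeries k) ∧
        v - algebraMap k V (PowerSeries.constantCoeff q) ∈ maximalIdeal V ∧
        (v ∈ maximalIdeal V → PowerSeries.constantCoeff q = 0) := by
  obtain ⟨ψ, hinj, hres', hmax, -⟩ := exists_algHom_powerSeries hres
  let g : V →ₐ[k] LaurentSeries k :=
    { toRingHom := (HahnSeries.ofPowerSeries ℤ k).comp ψ.toRingHom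
      commutes' := fun c => by
        change HahnSeries.ofPowerSeries ℤ k (ψ (algebraMap k V c)) = algebraMap k (LaurentSeries k) c
        rw [ψ.commutes, HahnSeries.algebraMap_apply'] }
  have hg : Function.Injective g := HahnSeries.ofPowerSeries_injective.comp hinj
  refine ⟨IsFractionRing.liftAlgHom hg, fun v => ⟨ψ v, ?_, hres' v, hmax v⟩⟩
  rw [IsFractionRing.liftAlgHom_apply, IsFractionRing.lift_algebraMap]
  rfl

end CoefficientField

end Literature.RingTheory.DiscreteValuationRing

end
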